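import Literature.NumberTheory.Automorphic.ReductiveGroupData
import Literature.NumberTheory.Automorphic.AdicCompletionLocalField
import HarnessLib

/-!
# `GL_N(𝒪)` acts transitively on primitive vectors

Topic `NumberTheory/Automorphic`; namespace `Literature.NumberTheory.Automorphic.GLn`.  KERNEL ONLY: theorems, 0 definitions,
0 records, 0 named facts, 0 sorry.

For a field `K` with a valuative relation (valuation ring `𝒪 = 𝒪[K]`, the tree's `glInt N K = GL_N(𝒪) ≤ GL_N(K)` of
`ReductiveGroupData`): a vector `x ∈ 𝒪ᴺ` one of whose coordinates is a UNIT (a «primitive» vector) is the image of a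
standard basis vector under an element of `GL_N(𝒪)` — the matrix `1` with its `i₀`-th column replaced by `x` has
determinant `x_{i₀} ∈ 𝒪ˣ` (`Matrix.cramer_one`).  Hence `GL_N(𝒪)`-invariant functions on `Kᴺ` are constant on the
«shells» `{x : min_i v(x_i) = const}` — the first step of the classification of the spherical (`GL_N(𝒪)`-fixed) vectors
of the Schrödinger model `𝒮(Kᴺ)` ([BernsteinZelevinsky1976, §2]; used for the split-place spherical hypothesis (SPH) of
`Liu2021/Def411WeilCarriersSurvivalSplit`).

* `GLn.exists_mem_glInt_mulVec_single_eq` — transitivity on primitive vectors (any `[ValuativeRel K]`);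
* `GLn.exists_mem_glInt_mulVec_single_eq_of_valued` — the same for Mathlib's `Valued.v` on a completion `K_v`
  (`v(x_i) ≤ 1`, `v(x_{i₀}) = 1`).

## References
* [BernsteinZelevinsky1976] I. N. Bernstein, A. V. Zelevinsky, Russian Math. Surveys 31 (1976), §2 (spherical vectors).
* [PlatonovRapinchuk1994] V. Platonov, A. Rapinchuk (1994), §5.1 (`G_{𝒪_v}`).
-/

set_option autoImplicit false

noncomputable section

open scoped Matrix
open ValuativeRel

namespace Literature.NumberTheory.Automorphic.GLn

section Transitive

variable {K : Type*} [Field K] [ValuativeRel K] {N : ℕ}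

/-- **`GL_N(𝒪)` is transitive on primitive vectors**: if every coordinate of `x ∈ Kᴺ` is integral and `x_{i₀}` is a
unit of `𝒪`, then `x = g · e_{i₀}` for some `g ∈ GL_N(𝒪)` (the identity matrix with its `i₀`-th column replaced by `x`).
[cite: PlatonovRapinchuk1994, §5.1] -/
theorem exists_mem_glInt_mulVec_single_eq (x : Fin N → K) (hx : ∀ i, x i ∈ 𝒪[K]) (i₀ : Fin N)
    (hx₀ : valuation K (x i₀) = 1) :
    ∃ g : GL (Fin N) K, g ∈ glInt N K ∧ (g : Matrix (Fin N) (Fin N) K) *ᵥ Pi.single i₀ 1 = x := by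
  classical
  -- the integral matrix `1` with column `i₀` replaced by `x`
  let xo : Fin N → 𝒪[K] := fun i => ⟨x i, hx i⟩
  let M : Matrix (Fin N) (Fin N) 𝒪[K] := (1 : Matrix (Fin N) (Fin N) 𝒪[K]).updateCol i₀ xo
  -- its determinant is the unit `x_{i₀}`
  have hdet : M.det = xo i₀ := by
    rw [← Matrix.cramer_apply, Matrix.cramer_one]; rfl
  have hunit : IsUnit M.det := by
    rw [hdet, Valuation.Integers.isUnit_iff_valuation_eq_one (Valuation.integer.integers (valuation K))]
    exact hx₀
  obtain ⟨u, hu⟩ := (Matrix.isUnit_iff_isUnit_det M).2 hunit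
  refine ⟨Matrix.GeneralLinearGroup.map (𝒪[K]).subtype u, ⟨u, rfl⟩, ?_⟩
  -- the `i₀`-th column of `M` is `x`
  have hcoe : ((Matrix.GeneralLinearGroup.map (𝒪[K]).subtype u : GL (Fin N) K) : Matrix (Fin N) (Fin N) K) =
      M.map (𝒪[K]).subtype := by
    rw [← hu]; rfl
  rw [hcoe, Matrix.mulVec_single_one]
  ext i
  have hM : M i i₀ = xo i := by
    show Matrix.updateCol (1 : Matrix (Fin N) (Fin N) 𝒪[K]) i₀ xo i i₀ = xo i
    rw [Matrix.updateCol_self]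
  rw [Matrix.col_apply, Matrix.map_apply, hM]
  rfl

/-- **any two primitive vectors are `GL_N(𝒪)`-translates**: if `x, y ∈ 𝒪ᴺ` each have a unit coordinate, then
`y = g · x` for some `g ∈ GL_N(𝒪)` (through `e_i`, `e_i + e_j`, `e_j`, all primitive). [cite: PlatonovRapinchuk1994, §5.1] -/
theorem exists_mem_glInt_mulVec_eq_of_primitive (x y : Fin N → K) (hx : ∀ i, x i ∈ 𝒪[K]) (hy : ∀ i, y i ∈ 𝒪[K])
    {i₀ j₀ : Fin N} (hx₀ : valuation K (x i₀) = 1) (hy₀ : valuation K (y j₀) = 1) :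
    ∃ g : GL (Fin N) K, g ∈ glInt N K ∧ (g : Matrix (Fin N) (Fin N) K) *ᵥ x = y := by
  classical
  obtain ⟨gx, hgx, hx'⟩ := exists_mem_glInt_mulVec_single_eq x hx i₀ hx₀
  obtain ⟨gy, hgy, hy'⟩ := exists_mem_glInt_mulVec_single_eq y hy j₀ hy₀
  -- `e_{i₀} + e_{j₀}` (or `e_{i₀}` if `i₀ = j₀`) is primitive at both indices
  let z : Fin N → K := if i₀ = j₀ then Pi.single i₀ 1 else Pi.single i₀ 1 + Pi.single j₀ 1
  have hsingle : ∀ k i : Fin N, (Pi.single k (1 : K) : Fin N → K) i ∈ 𝒪[K] := fun k i => by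
    rw [Pi.single_apply]
    split_ifs
    exacts [one_mem _, zero_mem _]
  have hz : ∀ i, z i ∈ 𝒪[K] := by
    intro i
    by_cases h : i₀ = j₀
    · simp only [z, h, if_true]
      exact hsingle _ _
    · simp only [z, h, if_false, Pi.add_apply]
      exact add_mem (hsingle _ _) (hsingle _ _)
  have hz₁ : valuation K (z i₀) = 1 := by
    by_cases h : i₀ = j₀
    · simp only [z, h, if_true, Pi.single_eq_same, map_one]
    · simp only [z, h, if_false, Pi.add_apply, Pi.single_eq_same, Pi.single_eq_of_ne h, add_zero, map_one]
  have hz₂ : valuation K (z j₀) = 1 := by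
    by_cases h : i₀ = j₀
    · simp only [z, h, if_true, Pi.single_eq_same, map_one]
    · have h' : j₀ ≠ i₀ := fun e => h e.symm
      simp only [z, h, if_false, Pi.add_apply, Pi.single_eq_same, Pi.single_eq_of_ne h', zero_add, map_one]
  obtain ⟨a, ha, haz⟩ := exists_mem_glInt_mulVec_single_eq z hz i₀ hz₁
  obtain ⟨b, hb, hbz⟩ := exists_mem_glInt_mulVec_single_eq z hz j₀ hz₂
  -- `y = gy e_{j₀} = gy b⁻¹ z = gy b⁻¹ a e_{i₀} = gy b⁻¹ a gx⁻¹ x`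
  refine ⟨gy * b⁻¹ * a * gx⁻¹, Subgroup.mul_mem _ (Subgroup.mul_mem _ (Subgroup.mul_mem _ hgy (Subgroup.inv_mem _ hb)) ha)
    (Subgroup.inv_mem _ hgx), ?_⟩
  have hgx' : ((gx⁻¹ : GL (Fin N) K) : Matrix (Fin N) (Fin N) K) *ᵥ x = Pi.single i₀ 1 := by
    rw [← hx', Matrix.mulVec_mulVec, ← Units.val_mul, inv_mul_cancel, Units.val_one, Matrix.one_mulVec]
  have hb' : ((b⁻¹ : GL (Fin N) K) : Matrix (Fin N) (Fin N) K) *ᵥ z = Pi.single j₀ 1 := by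
    rw [← hbz, Matrix.mulVec_mulVec, ← Units.val_mul, inv_mul_cancel, Units.val_one, Matrix.one_mulVec]
  rw [Units.val_mul, Units.val_mul, Units.val_mul, ← Matrix.mulVec_mulVec, hgx', ← Matrix.mulVec_mulVec, haz,
    ← Matrix.mulVec_mulVec, hb', hy']

/-- **two vectors of the same content are `GL_N(𝒪)`-translates**: `c • x₀` and `c • y₀` with `x₀, y₀` primitive.
[cite: PlatonovRapinchuk1994, §5.1] -/
theorem exists_mem_glInt_mulVec_eq_of_smul_primitive (c : K) (x₀ y₀ : Fin N → K) (hx : ∀ i, x₀ i ∈ 𝒪[K])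
    (hy : ∀ i, y₀ i ∈ 𝒪[K]) {i₀ j₀ : Fin N} (hx₀ : valuation K (x₀ i₀) = 1) (hy₀ : valuation K (y₀ j₀) = 1) :
    ∃ g : GL (Fin N) K, g ∈ glInt N K ∧ (g : Matrix (Fin N) (Fin N) K) *ᵥ (c • x₀) = c • y₀ := by
  obtain ⟨g, hg, h⟩ := exists_mem_glInt_mulVec_eq_of_primitive x₀ y₀ hx hy hx₀ hy₀
  exact ⟨g, hg, by rw [Matrix.mulVec_smul, h]⟩

/-- **`GL_N(𝒪)`-invariant functions are constant on shells**: if `f (g · x) = f x` for all `g ∈ GL_N(𝒪)`, then `f`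
takes the same value at `c • x₀` and `c • y₀` for primitive `x₀, y₀`. [cite: BernsteinZelevinsky1976, §2] -/
theorem apply_eq_of_invariant_of_smul_primitive {α : Type*} (f : (Fin N → K) → α)
    (hf : ∀ g : GL (Fin N) K, g ∈ glInt N K → ∀ x, f ((g : Matrix (Fin N) (Fin N) K) *ᵥ x) = f x)
    (c : K) (x₀ y₀ : Fin N → K) (hx : ∀ i, x₀ i ∈ 𝒪[K]) (hy : ∀ i, y₀ i ∈ 𝒪[K]) {i₀ j₀ : Fin N}
    (hx₀ : valuation K (x₀ i₀) = 1) (hy₀ : valuation K (y₀ j₀) = 1) : f (c • x₀) = f (c • y₀) := by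
  obtain ⟨g, hg, h⟩ := exists_mem_glInt_mulVec_eq_of_smul_primitive c x₀ y₀ hx hy hx₀ hy₀
  rw [← h, hf g hg]

end Transitive

section Valued

open NumberField IsDedekindDomain

variable {F : Type} [Field F] [NumberField F] (v : HeightOneSpectrum (𝓞 F)) {N : ℕ}

/-- **`GL_N(𝒪_v)` is transitive on primitive vectors of `F_vᴺ`** (Mathlib's `Valued.v`: `v(x_i) ≤ 1` for all `i` and
`v(x_{i₀}) = 1`). [cite: PlatonovRapinchuk1994, §5.1] -/
theorem exists_mem_glInt_mulVec_single_eq_of_valued (x : Fin N → v.adicCompletion F)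
    (hx : ∀ i, Valued.v (x i) ≤ 1) (i₀ : Fin N) (hx₀ : Valued.v (x i₀) = 1) :
    ∃ g : GL (Fin N) (v.adicCompletion F), g ∈ glInt N (v.adicCompletion F) ∧
      (g : Matrix (Fin N) (Fin N) (v.adicCompletion F)) *ᵥ Pi.single i₀ 1 = x := by
  refine exists_mem_glInt_mulVec_single_eq x (fun i => ?_) i₀ ?_
  · exact (Valuation.mem_integer_iff _ _).2
      ((Valuation.vle_one_iff (valuation (v.adicCompletion F))).1 ((Valuation.vle_one_iff Valued.v).2 (hx i)))
  · exact ((ValuativeRel.isEquiv Valued.v (valuation (v.adicCompletion F))).eq_one_iff_eq_one).1 hx₀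

end Valued

end Literature.NumberTheory.Automorphic.GLn
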